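import Literature.NumberTheory.EllipticCurves.CastellaGrossiLeeSkinner2022.KatzPAdicLFunctionFrame
import HarnessLib

/-!
# `Cbar`-independence of the Katz frame `IsKatzLFunction` at an exact conductor set
# (Castella–Grossi–Lee–Skinner 2022, Thm. 2.1.2; Kriz 2016, Thm. 27 — reading lemmas, no new fact)

Cell `bsd-eis` (FULL-BSD rank-≤1 programme, home `run/shared/lean/pub/bsd-eis/`), width seat
`bsd-line-x1-p1-w2` gen 15, crux 2 `GoodLatticeBDPValue` (stmt-BirchSwinnertonDyer-19032), line
`halves` v33N. THREE PROVED READING LEMMAS about the tree's characterising predicate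
`CastellaGrossiLeeSkinner2022.IsKatzLFunction ι v vbar Cbar κ γ θK ΩK Ωp L`
(`KatzPAdicLFunctionFrame.lean`), whose parameter `Cbar` (meant: `{w̄ : w ∣ 𝔠}`, `𝓞_K/𝔠 = ℤ/Cℤ`,
`C = cond θ`) enters ONLY through the away factor
`katzAwayFactor θK φ Cbar = ∏_{u ∈ Cbar} (1 − θ_K⁰(u) φ⁰(u) (N u)⁻¹)` (extended-by-zero values):

* `katzAwayFactor_empty` — at `Cbar = ∅` the factor is `1`;
* `katzInterpolationValue_eq_empty_of_forall_not_isUnramifiedAt` — if `θ_K` is ramified at every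
  `u ∈ Cbar` (the EXACT-conductor reading, under which the frame file's
  `katzAwayFactor_eq_one_of_forall_not_isUnramifiedAt` gives factor `1`), the interpolation value
  equals the one at `Cbar = ∅`;
* `isKatzLFunction_iff_empty_of_forall_not_isUnramifiedAt` — under the same hypothesis
  `IsKatzLFunction … Cbar … ↔ IsKatzLFunction … ∅ …`.

WHY (binder audit of the crux-2 content stub, 2026-08-29): the named facts
`KellerYin2024.thm222_anacong_goodLattice_{of_ne_one, of_five_le, of_fullDescentDatum, OPEN}`
(CGLS Thm. 2.2.2 shapes) bind `∀ (Cbar : Finset _), (∀ u ∈ Cbar, ¬ θK.IsUnramifiedAt u) →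
∀ … (Lφ : UnrSeries p), … IsKatzLFunction ι' v vbar Cbar κ γ θK … Lφ → …` and conclude a
`λ`-identity for `Lφ`. Were the frame `Cbar`-dependent under that hypothesis, the `∀ Cbar` would
range over DIFFERENT `L`-functions (differing by Euler factors, hence by `λ`) and the statements would
be stronger than print (indeed false). The third lemma shows it does not: every admissible `Cbar`
names the SAME predicate as `Cbar = ∅`, i.e. ONE `𝓛_θ` — the printed one for `C = cond θ` exact
(CGLS: "for each `ℓ ∣ C` we take the prime `w ∣ ℓ` with `w ∣ 𝔠`", the factor `(1 − θ(ℓ)ξ(w)ℓ⁻¹)`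
vanishing to `1` termwise since `θ(ℓ) = 0` for `ℓ ∣ cond θ` in Kriz's convention). Pure unfolding;
no mathematical content beyond `Finset.prod` bookkeeping; nothing asserted about Katz's measure.
No summit statement, no case of BSD, no crux or stub is proved by this file.

References: [CastellaGrossiLeeSkinner2022] Thm. 2.1.2 (arXiv:2008.02571v2 TeX L1015–1041);
[Kriz2016] Thm. 27 (arXiv:1512.05032 p. 18: the factor `∏_{v ∣ 𝔆}(1 − χ(v))`).
-/

noncomputable section

open scoped MatrixGroups Topology
open NumberField IsDedekindDomain Field Polynomial
open Literature.NumberTheory.GaloisRepresentations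

namespace Literature.NumberTheory.EllipticCurves.CastellaGrossiLeeSkinner2022

universe u

variable {K : Type u} [Field K] [NumberField K]

/-- At `Cbar = ∅` the away-from-`p` factor `∏_{u ∈ Cbar}(1 − θ_K⁰(u) φ⁰(u) (N u)⁻¹)` of CGLS
Thm. 2.1.2 / Kriz Thm. 27 is the empty product `1`.
[cite: Kriz2016, Thm. 27 (arXiv:1512.05032 p. 18)] -/
theorem katzAwayFactor_empty (θK φ : HeckeCharacter K) : katzAwayFactor θK φ ∅ = 1 :=
  katzAwayFactor_eq_one_of_forall_not_isUnramifiedAt φ fun u hu ↦ absurd hu (Finset.notMem_empty u)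

/-- **`Cbar`-independence of the Katz interpolation value at an exact conductor set**: if `θ_K` is
ramified at every `u ∈ Cbar` (the reading `Cbar = {w̄ : w ∣ 𝔠}`, `C = cond θ` exact, under which
every away factor is `1 − 0 = 1`, `katzAwayFactor_eq_one_of_forall_not_isUnramifiedAt`), then
`katzInterpolationValue p θK v vbar Cbar φ n ΩK Lval = katzInterpolationValue p θK v vbar ∅ φ n ΩK Lval`.
[cite: CastellaGrossiLeeSkinner2022, Thm. 2.1.2 (arXiv:2008.02571v2 TeX L1015–1041)]
[cite: Kriz2016, Thm. 27 (arXiv:1512.05032 p. 18)] -/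
theorem katzInterpolationValue_eq_empty_of_forall_not_isUnramifiedAt (p : ℕ)
    {θK : HeckeCharacter K} (v vbar : HeightOneSpectrum (𝓞 K))
    {Cbar : Finset (HeightOneSpectrum (𝓞 K))} (h : ∀ u ∈ Cbar, ¬ θK.IsUnramifiedAt u)
    (φ : HeckeCharacter K) (n : ℕ) (ΩK Lval : ℂ) :
    katzInterpolationValue p θK v vbar Cbar φ n ΩK Lval =
      katzInterpolationValue p θK v vbar ∅ φ n ΩK Lval := by
  unfold katzInterpolationValue
  rw [katzAwayFactor_eq_one_of_forall_not_isUnramifiedAt φ h, katzAwayFactor_empty]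

variable {p : ℕ} [Fact p.Prime]

/-- **`Cbar`-independence of the frame `IsKatzLFunction` at an exact conductor set**: if `θ_K` is
ramified at every `u ∈ Cbar`, then `IsKatzLFunction ι v vbar Cbar κ γ θK ΩK Ωp L ↔
IsKatzLFunction ι v vbar ∅ κ γ θK ΩK Ωp L` (same evaluation points `T = φ̂(γ) − 1`, same values).
Consequently the binders `∀ Cbar, (∀ u ∈ Cbar, ¬ θK.IsUnramifiedAt u) → ∀ Lφ, IsKatzLFunction …
Cbar … Lφ → …` of the CGLS-Thm.-2.2.2-shaped named facts
`KellerYin2024.thm222_anacong_goodLattice_{of_ne_one,of_five_le,of_fullDescentDatum,OPEN}` quantify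
over ONE characterising predicate (the `Cbar = ∅` one), not over a family of `p`-adic `L`-functions
differing by Euler factors: on this axis those statements are NOT stronger than print.
[cite: CastellaGrossiLeeSkinner2022, Thm. 2.1.2 (arXiv:2008.02571v2 TeX L1015–1041), Thm. 2.2.2 (`cor:Kriz`, TeX L1124–1153)]
[cite: Kriz2016, Thm. 27 (arXiv:1512.05032 p. 18)] -/
theorem isKatzLFunction_iff_empty_of_forall_not_isUnramifiedAt (ι : PadicAlgCl p ≃+* ℂ)
    (v vbar : HeightOneSpectrum (𝓞 K)) {Cbar : Finset (HeightOneSpectrum (𝓞 K))}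
    (κ : ZpExtension K p) (γ : absoluteGaloisGroup K) {θK : HeckeCharacter K}
    (h : ∀ u ∈ Cbar, ¬ θK.IsUnramifiedAt u) (ΩK : ℂ) (Ωp : ℂ_[p]) (L : UnrSeries p) :
    IsKatzLFunction ι v vbar Cbar κ γ θK ΩK Ωp L ↔ IsKatzLFunction ι v vbar ∅ κ γ θK ΩK Ωp L := by
  unfold IsKatzLFunction
  simp only [katzInterpolationValue_eq_empty_of_forall_not_isUnramifiedAt p v vbar h]

end Literature.NumberTheory.EllipticCurves.CastellaGrossiLeeSkinner2022

end
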